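import Summits.QuantumFields.YangMills.Theorems.BalabanUVNodesN21GappedTopPairReading13CoPHDefsCmap
import Summits.QuantumFields.YangMills.Theorems.BalabanUVNodesN20KeyedRelWeightCutZero

/-!
# BalabanUVNodes ∕ N20 (NE7b) — THE N20 COLUMN AT THE DOUBLY-GAPPED χ-GENERIC SPINE READING `crGap2₁₃VAtCmap Χ K₀ jcut ρ ρ′ n₁ n₂` AND ITS RE-CENTRED INSTANCE
# `crGap2₁₃VAx` (THE K3ᴬ v8 PIN's READING): the FREE END at the zero cut (hypothesis-free), the witness socket, and the `KeyedRelWeight` binder shapes of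
# `K3Skeleton13SepCoPHAxV8.stub_expansion13HV` spelled out

Cell `pub-ymgap` (HUMAN RULING D-0062, Track A), seat `pub-ymgap-dag-n20-d` (gen 46; R134 (a) N20 s3), node N20 = NE7b.  Supply for K3ᴬ `SpineGivenEndpointR13SepCoPHVAx` =
stmt-QuantumFields-27247 (skeleton v8 `K3Skeleton13SepCoPHAxV8` b38fad1764a2d455 REGISTERED 2026-08-31T04:29Z, stubs `stub_rates13HV` ∕ `stub_expansion13HV`; dag-lead g41 WORDS 625 (1):
by-name stub targets on K3ᴬ for all K3 hands); `--kind proof --supports stmt-QuantumFields-27247 --as helper`; COUNT-NEUTRAL; LOCATED.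
[III] = [Balaban1988Convergent], [LF-I] = [Balaban1989LargeFieldI], [LF-II] = [Balaban1989LargeFieldII].

WHY.  v8's stub 2 asks for `∃ jc ρ ρ′ n₁ n₂ cr, PinnedAtLiveGap2 jc ρ ρ′ n₁ n₂ cr ∧ DialRows ρ ρ′ n₁ n₂ ∧ KeyedRelWeight cr ∧ KeyedShellWeight cr ∧ KeyedExtractionV cr ∧
KeyedCoreEdgeHolderD4V β cr (rrOfRecord 𝔯 ksel)`, the pin naming dag-n15-a's χ-generic DOUBLY-GAPPED reading RE-CENTRED at `χ := chiβOfRecord₁₃Ax θ`: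
`crGap2₁₃VAx (jc …) ρ ρ′ n₁ n₂ := crGap2₁₃VAtCmap (fun F ↦ chiβOfRecord₁₃Ax F N) 0 …` (`Thm/BalabanUVNodesN21GappedTopPairReading13CoPHDefsCmap` §D4χ ∕ §A).  The N20 column was
typed at the CoPH readings only (this lineage g0 `…N20KeyedRelWeightCutZero` at `crOfRecord₁₃(At)`, dag-n20-w2 `…N20KeyedRelWeightAtGappedReading` at the single-gap `crGap₁₃VAt`,
dag-n21 `…GappedPairRoadN20Invariance` at `crGap2₁₃V` on the live line); off the record's own β-slot there is no `rfl` receipt, so NOTHING of it is citable at the v8 pin.  This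
file is the χ-generic re-issue of the part of the column that is HYPOTHESIS-FREE — exactly what a v8 closer reads at `jc ≡ 0` — plus the socket for any cut:
* §1 `badClass₁₃Chi_cutZero` (the χ-bad class of the zero policy is EMPTY, every `θ χ K₀ g₀ K t`) · `classSet₁₃Chi_sdiff_badClass₁₃Chi_cutZero` (the good class is then EVERYTHING);
* §2 ★★ `relWeightBound_badKeysSigma_cutZero` — ANY class-set family `T`, ANY carriers `A B`, ANY `l₀`: `RelWeightBound l₀ T A B (badKeysSigma (T ·) 0) 0` (no sign condition,
  no estimate) · `relWeightBound_chiKeys_cutZero` (at `classSet₁₃Chi ∕ badClass₁₃Chi … (fun _ ↦ 0)`, any carriers);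
* §3 AT THE READINGS (any `Χ K₀ ρ ρ′ n₁ n₂ sh`, EVERY χ-keyed Stage-13 tuple): ★ `relWeightBound_crGap2₁₃VAtCmap` (the N20 SOCKET at the doubly-gapped χ-reading: ANY witness at its
  carriers gives the face at the reading's canonical `W := wInf …`), ★★ `relWeightBound_crGap2₁₃VAtCmap_cutZero` · `W_crGap2₁₃VAtCmap_cutZero` (`W ≡ 0`), and the same free end at
  T3's readings of record `relWeightBound_crOfRecord₁₃AtCmap_cutZero ∕ …VAtCmap_cutZero` · `W_crOfRecord₁₃AtCmap_cutZero`;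
* §4 THE K3ᴬ v8 BINDER SHAPES (`N = 2`, `hP : θ.Provisos₁₃CoPHAx F 2`, guards `θ.ZhUnity ∧ θ.SlotsNondegenerate₁₃Ax`, `θ.Admissible`): ★★ `keyedRelWeight_shape_crGap2₁₃VAx_cutZero`
  = v8's `KeyedRelWeight (crGap2₁₃VAx (fun _ ↦ 0) ρ ρ′ n₁ n₂)` UNFOLDED VERBATIM, hypothesis-free at EVERY tuple (no live ∕ off-live split is needed for N20 at the free end; the
  witness `cr := crGap2₁₃VAx (fun _ ↦ 0) ρ ρ′ n₁ n₂` satisfies `PinnedAtLiveGap2 (fun _ _ _ _ _ ↦ fun _ ↦ 0) ρ ρ′ n₁ n₂ cr` by `rfl`), and ★ `keyedRelWeight_shape_crGap2₁₃VAx_of_witness`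
  (any per-tuple cut reading `jc`: a keyed family of witnesses at the gapped Ax carriers ⇒ the body at `fun F θ hP g₀ os ↦ crGap2₁₃VAx (jc F θ hP g₀ os) ρ ρ′ n₁ n₂ F θ hP g₀ os` —
  the socket this lineage's PRICED faces of record (road [e], `…CeilingUndressedAE(Prefix)`) would plug into at a nonzero cut, once re-issued over `χ`).
WHAT IT SAYS (located, count-neutral): at the v8 pin the N20 conjunct books NOTHING at `jc ≡ 0` — the located reading since p590852 (dag-n20-w1) ∕ plan g81 (t-JC): the cut's
content sits in the JOINT choice with `KeyedCoreEdgeHolderD4V` (whose good class at `jc ≡ 0` is ALL of `classSet₁₃Chi`, §1) — now citable BY NAME at the re-centred χ-reading.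
Cited BY NAME, not re-typed: dag-n15-a `…N21GappedTopPairReading13CoPHDefsCmap` (`crGap2₁₃VAtCmap ∕ crGap2₁₃VAx`, dictionary), this lineage's T3 `…SpineReadingOfRecord13CoPHChi`
(`classSet₁₃Chi ∕ badClass₁₃Chi ∕ crOfRecord₁₃(V)AtCmap`, transfers) and T2-core `…SpineCarriersOfRecord13CoPHCmap` (`SpineReading₁₃CoPHAx`), g0 `…N20KeyedRelWeightCutZero`
(`badKeysSigma_policy_zero`), `…SpineCanonicalWeights` (`wInf`, `relWeightBound_wInf`), `Node00.TwoRunSitePersistence` (`badKeysSigma`).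

HONEST FRAMING.  [folklore] finite-sum bookkeeping BY NAME; NO weight bounded, NO estimate proved; nothing of Bałaban's is asserted, ported or discharged; NE7 ∕ NE7b ∕ NE7c NOT
PRINTED for `d = 4`, NOT proved; no `Provisos₁₃CoPHChi ∕ …Ax` inhabitant claimed (K0ᴬ OPEN); K3ᴬ stub 2 is NOT closed by this (its `KeyedCoreEdgeHolderD4V` conjunct is NE7 proper on
every keyed class at `jc ≡ 0`); K-Ax cruxes 3∕3 OPEN; N19 ∕ N20 ∕ N21 ∕ N27 NOT discharged; counts UNMOVED (typed 28∕28 · discharged 8∕27 · K 1∕4); no count claim (the chair's single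
count line is the only count).  One finite `𝕋⁴_{L^K}` programme at fixed `ε = L^{−K}`, Bałaban AS PRINTED; the YM mass gap (Clay) is NOT proved by any of this — R4 closes the
conditional finite-𝕋⁴ rung `BalabanLadder.UV` only; NOT ℝ⁴, NOT infinite volume, NOT OS.  No `def`, no `instance`, no `notation`, no `sorry`, no `axiom`.
Sources (locators, bookkeeping only): [III] (2.18) p.257; [LF-I] p.181; [LF-II] Thm 1 + (0.1) pp.355–356, (1.80) p.384; [King1986] (3.10)–(3.11) p.656.
-/

noncomputable section

open scoped BigOperators

namespace Summit.QuantumFields.YangMills.BalabanUVNodes.N20KeyedRelWeightAtGap2ReadingCmap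

open Literature.MathematicalPhysics.QuantumFieldTheory.Balaban1983to89 Literature.MathematicalPhysics.QuantumFieldTheory.Balaban1983to89.Node00
open T4Continuum
open T4WeightBudget (RelWeightBound)
open YMDAG.UVSplit
open Summit.QuantumFields.YangMills.BalabanUVNodes.SpineCanonicalWeights
open Summit.QuantumFields.YangMills.Theorems.N21ShellSplitOfRecord13CoPH (WidthLetter₁₃CoPHCmap DepthLetter₁₃CoPHCmap WidthLetter₁₃CoPHAx DepthLetter₁₃CoPHAx)
open Summit.QuantumFields.YangMills.Theorems.N21GappedTopPair13CoPH (gapWeight2A₁₃Chi gapWeight2B₁₃Chi crGap2₁₃VAtCmap crGap2₁₃VCmap crGap2₁₃VAtAx crGap2₁₃VAx)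
open Summit.QuantumFields.YangMills.BalabanUVNodes.N20KeyedRelWeightCutZero (badKeysSigma_policy_zero)

variable {F : T4Family} {N : ℕ} [NeZero N]

/-! ## §1  At the zero policy the χ-bad class is EMPTY and the good class is everything -/

section BadClass

variable (θ : Stage13HParams F N) (χ : ChiSlot F N) (K₀ : ℕ) (g₀ : ℕ → ℝ)

/-- **THE χ-BAD CLASS OF THE ZERO POLICY IS EMPTY** at every step and source (no key has an old large-field region below level `0`; g0's `badKeysSigma_policy_zero` at the
χ-class set). [cite: Balaban1989LargeFieldII, (1.80) p.384; King1986, (3.10) p.656 (bookkeeping)] -/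
theorem badClass₁₃Chi_cutZero (K : ℕ) (t : ℝ) : badClass₁₃Chi θ χ K₀ g₀ (fun _ => 0) K t = ∅ :=
  badKeysSigma_policy_zero F _

/-- **… so the GOOD class of the zero policy is the WHOLE χ-class set** — what the core-edge conjunct of a v8 closer at `jc ≡ 0` has to compare the two runs on.
[cite: King1986, (3.10) p.656 (bookkeeping)] -/
theorem classSet₁₃Chi_sdiff_badClass₁₃Chi_cutZero [DecidableEq ((K : ℕ) × SiteSeqKey F (K₀ + K))] (K : ℕ) (t : ℝ) :
    classSet₁₃Chi θ χ K₀ g₀ K \ badClass₁₃Chi θ χ K₀ g₀ (fun _ => 0) K t = classSet₁₃Chi θ χ K₀ g₀ K := by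
  rw [badClass₁₃Chi_cutZero, Finset.sdiff_empty]

end BadClass

/-! ## §2  The free end at the carriers: ANY class sets, ANY carriers, the zero policy, the zero weight -/

section Carriers

/-- **★★ `RelWeightBound` FOR THE σ-PACKED BAD CLASS OF THE ZERO POLICY WITH THE ZERO WEIGHT — ANY class-set family `T`, ANY carriers `A B`, ANY source range `l₀`**
(`badKeysSigma (T K) 0 = ∅`: both bad sums vanish; `0 ≤ 0 < 1`, summable).  No sign condition on the carriers, no estimate.
[cite: King1986, (3.10) p.656; Balaban1989LargeFieldII, (1.80) p.384 (bookkeeping)] -/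
theorem relWeightBound_badKeysSigma_cutZero {K₀ : ℕ} (l₀ : ℝ) (T : ℕ → Finset (Σ K, SiteSeqKey F (K₀ + K))) (A B : ℕ → ℝ → (Σ K, SiteSeqKey F (K₀ + K)) → ℝ) :
    RelWeightBound l₀ T A B (fun K _ => badKeysSigma F (T K) (fun _ => 0)) (fun _ => 0) where
  bad_subset K _ _ := badKeysSigma_subset F (T K) _
  nonneg _ := le_rfl
  lt_one _ := zero_lt_one
  summable := summable_zero
  bad_left K _ _ := by rw [badKeysSigma_policy_zero, Finset.sum_empty, zero_mul]
  bad_right K _ _ := by rw [badKeysSigma_policy_zero, Finset.sum_empty, zero_mul]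

/-- **`RelWeightBound` AT THE χ-CLASS SETS WITH THE ZERO POLICY AND THE ZERO WEIGHT, ANY CARRIERS `A B`** (every `θ χ K₀ g₀`; in particular the gapped, doubly-gapped, banded or
plain χ-class weights of record). [cite: King1986, (3.10) p.656; Balaban1989LargeFieldII, (1.80) p.384 (bookkeeping)] -/
theorem relWeightBound_chiKeys_cutZero (θ : Stage13HParams F N) (χ : ChiSlot F N) (K₀ : ℕ) (g₀ : ℕ → ℝ) (l₀ : ℝ) (A B : ℕ → ℝ → (Σ K, SiteSeqKey F (K₀ + K)) → ℝ) :
    RelWeightBound l₀ (classSet₁₃Chi θ χ K₀ g₀) A B (badClass₁₃Chi θ χ K₀ g₀ (fun _ => 0)) (fun _ => 0) :=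
  relWeightBound_badKeysSigma_cutZero l₀ (classSet₁₃Chi θ χ K₀ g₀) A B

end Carriers

/-! ## §3  At the readings: the socket of the doubly-gapped χ-reading, and the free end at it and at the χ-readings of record -/

section Readings

variable (Χ : (F : T4Family) → Stage13Params F N → ChiSlot F N) (K₀ : ℕ) (jcut : ℕ → ℕ) (ρ ρ' : WidthLetter₁₃CoPHCmap N Χ) (n₁ n₂ : DepthLetter₁₃CoPHCmap N Χ)
  (θ : Stage13HParams F N) (hP : θ.Provisos₁₃CoPHChi F N (Χ F θ.toStage13Params)) (g₀ : ℕ → ℝ) (os : List (ULoop F))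

/-- **★ THE N20 SOCKET AT THE DOUBLY-GAPPED χ-READING**: a `RelWeightBound` with ANY weight sequence at the reading's carriers (χ-class set, doubly-gapped χ-class weights, χ-bad
class of `jcut`) gives the face AT THE READING, whose `W` is the canonical `wInf …` (`relWeightBound_wInf`). [cite: Balaban1989LargeFieldII, Thm 1 + (0.1) pp.355–356, (1.80) p.384; King1986, (3.10)–(3.11) p.656 (bookkeeping)] -/
theorem relWeightBound_crGap2₁₃VAtCmap {W : ℕ → ℝ}
    (h : RelWeightBound 1 (classSet₁₃Chi θ (Χ F θ.toStage13Params) K₀ g₀)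
      (gapWeight2A₁₃Chi θ (Χ F θ.toStage13Params) hP K₀ g₀ os (ρ F θ hP g₀ os) (ρ' F θ hP g₀ os) (n₁ F θ hP g₀ os) (n₂ F θ hP g₀ os))
      (gapWeight2B₁₃Chi θ (Χ F θ.toStage13Params) hP K₀ g₀ os (ρ F θ hP g₀ os) (ρ' F θ hP g₀ os) (n₁ F θ hP g₀ os) (n₂ F θ hP g₀ os))
      (badClass₁₃Chi θ (Χ F θ.toStage13Params) K₀ g₀ jcut) W) :
    RelWeightBound (crGap2₁₃VAtCmap Χ K₀ jcut ρ ρ' n₁ n₂ F θ hP g₀ os).l₀ (crGap2₁₃VAtCmap Χ K₀ jcut ρ ρ' n₁ n₂ F θ hP g₀ os).T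
      (crGap2₁₃VAtCmap Χ K₀ jcut ρ ρ' n₁ n₂ F θ hP g₀ os).A (crGap2₁₃VAtCmap Χ K₀ jcut ρ ρ' n₁ n₂ F θ hP g₀ os).B
      (crGap2₁₃VAtCmap Χ K₀ jcut ρ ρ' n₁ n₂ F θ hP g₀ os).Bad (crGap2₁₃VAtCmap Χ K₀ jcut ρ ρ' n₁ n₂ F θ hP g₀ os).W :=
  relWeightBound_wInf h

/-- **★★ THE N20 FACE AT THE DOUBLY-GAPPED χ-READING WITH THE ZERO POLICY HOLDS FOR EVERY TUPLE, UNCONDITIONALLY** (the reading's canonical `W` inherits the zero witness of §2).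
[cite: King1986, (3.10) p.656; Balaban1989LargeFieldII, Thm 1 + (0.1) pp.355–356, (1.80) p.384 (bookkeeping)] -/
theorem relWeightBound_crGap2₁₃VAtCmap_cutZero :
    RelWeightBound (crGap2₁₃VAtCmap Χ K₀ (fun _ => 0) ρ ρ' n₁ n₂ F θ hP g₀ os).l₀ (crGap2₁₃VAtCmap Χ K₀ (fun _ => 0) ρ ρ' n₁ n₂ F θ hP g₀ os).T
      (crGap2₁₃VAtCmap Χ K₀ (fun _ => 0) ρ ρ' n₁ n₂ F θ hP g₀ os).A (crGap2₁₃VAtCmap Χ K₀ (fun _ => 0) ρ ρ' n₁ n₂ F θ hP g₀ os).B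
      (crGap2₁₃VAtCmap Χ K₀ (fun _ => 0) ρ ρ' n₁ n₂ F θ hP g₀ os).Bad (crGap2₁₃VAtCmap Χ K₀ (fun _ => 0) ρ ρ' n₁ n₂ F θ hP g₀ os).W :=
  relWeightBound_crGap2₁₃VAtCmap Χ K₀ _ ρ ρ' n₁ n₂ θ hP g₀ os (relWeightBound_chiKeys_cutZero θ _ K₀ g₀ 1 _ _)

/-- **DICTIONARY: WITH THE ZERO POLICY THE DOUBLY-GAPPED χ-READING's CANONICAL FRACTION IS `0`** at every step. [cite: King1986, (3.10) p.656 (bookkeeping)] -/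
theorem W_crGap2₁₃VAtCmap_cutZero (K : ℕ) : (crGap2₁₃VAtCmap Χ K₀ (fun _ => 0) ρ ρ' n₁ n₂ F θ hP g₀ os).W K = 0 :=
  le_antisymm (wInf_le_of_relWeightBound (relWeightBound_chiKeys_cutZero θ _ K₀ g₀ 1 _ _) K) (wInf_nonneg K)

variable (sh : ShellSplit₁₃CoPHCmap N Χ K₀)

/-- **THE N20 FACE AT T3's χ-READING OF RECORD `crOfRecord₁₃AtCmap Χ K₀ (fun _ ↦ 0) sh` HOLDS FOR EVERY TUPLE, UNCONDITIONALLY** (T3's transfer `relWeightBound_crOfRecord₁₃AtCmap`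
at the zero witness of §2). [cite: King1986, (3.10) p.656; Balaban1989LargeFieldII, Thm 1 + (0.1) pp.355–356 (bookkeeping)] -/
theorem relWeightBound_crOfRecord₁₃AtCmap_cutZero :
    RelWeightBound (crOfRecord₁₃AtCmap Χ K₀ (fun _ => 0) sh F θ hP g₀ os).l₀ (crOfRecord₁₃AtCmap Χ K₀ (fun _ => 0) sh F θ hP g₀ os).T
      (crOfRecord₁₃AtCmap Χ K₀ (fun _ => 0) sh F θ hP g₀ os).A (crOfRecord₁₃AtCmap Χ K₀ (fun _ => 0) sh F θ hP g₀ os).B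
      (crOfRecord₁₃AtCmap Χ K₀ (fun _ => 0) sh F θ hP g₀ os).Bad (crOfRecord₁₃AtCmap Χ K₀ (fun _ => 0) sh F θ hP g₀ os).W :=
  relWeightBound_crOfRecord₁₃AtCmap Χ K₀ _ sh θ hP g₀ os (relWeightBound_chiKeys_cutZero θ _ K₀ g₀ 1 _ _)

/-- **… and at the physical-volume χ-reading of record `crOfRecord₁₃VAtCmap Χ K₀ (fun _ ↦ 0) sh`.** [cite: King1986, (3.10) p.656; Balaban1989LargeFieldII, Thm 1 + (0.1) pp.355–356 (bookkeeping)] -/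
theorem relWeightBound_crOfRecord₁₃VAtCmap_cutZero :
    RelWeightBound (crOfRecord₁₃VAtCmap Χ K₀ (fun _ => 0) sh F θ hP g₀ os).l₀ (crOfRecord₁₃VAtCmap Χ K₀ (fun _ => 0) sh F θ hP g₀ os).T
      (crOfRecord₁₃VAtCmap Χ K₀ (fun _ => 0) sh F θ hP g₀ os).A (crOfRecord₁₃VAtCmap Χ K₀ (fun _ => 0) sh F θ hP g₀ os).B
      (crOfRecord₁₃VAtCmap Χ K₀ (fun _ => 0) sh F θ hP g₀ os).Bad (crOfRecord₁₃VAtCmap Χ K₀ (fun _ => 0) sh F θ hP g₀ os).W :=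
  relWeightBound_crOfRecord₁₃VAtCmap Χ K₀ _ sh θ hP g₀ os (relWeightBound_chiKeys_cutZero θ _ K₀ g₀ 1 _ _)

/-- **DICTIONARY: WITH THE ZERO POLICY THE χ-READING OF RECORD's CANONICAL FRACTION IS `0`** at every step (both volume letters read the same `W`, T3's `crOfRecord₁₃VAtCmap_W`).
[cite: King1986, (3.10) p.656 (bookkeeping)] -/
theorem W_crOfRecord₁₃AtCmap_cutZero (K : ℕ) : (crOfRecord₁₃AtCmap Χ K₀ (fun _ => 0) sh F θ hP g₀ os).W K = 0 :=
  le_antisymm (wInf_le_of_relWeightBound (relWeightBound_chiKeys_cutZero θ _ K₀ g₀ 1 _ _) K) (wInf_nonneg K)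

end Readings

/-! ## §4  The K3ᴬ v8 binder shapes (`N = 2`, RE-CENTRED slot `χ := chiβOfRecord₁₃Ax θ`, v8's `KeyedRelWeight` :412 and `PinnedAtLiveGap2` :564 shape
`cr F θ hP g₀ os = crGap2₁₃VAx (jc F θ hP g₀ os) ρ ρ′ n₁ n₂ F θ hP g₀ os`) -/

section Shape

/-- **★★ THE `KeyedRelWeight` BODY OF v8 AT THE RE-CENTRED DOUBLY-GAPPED READING WITH THE ZERO CUT READING, SPELLED OUT, HOLDS UNCONDITIONALLY** (`N = 2`; every Stage-13 tuple
with re-centred χ-provisos `θ.Provisos₁₃CoPHAx F 2`, every `g₀`, `os` — the guards `θ.ZhUnity ∧ θ.SlotsNondegenerate₁₃Ax` and `θ.Admissible` are NOT used): the N20 conjunct of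
`K3Skeleton13SepCoPHAxV8.stub_expansion13HV` at the witness `jc := fun _ _ _ _ _ ↦ fun _ ↦ 0`, `cr := crGap2₁₃VAx (fun _ ↦ 0) ρ ρ′ n₁ n₂` (which satisfies `PinnedAtLiveGap2 jc ρ ρ′ n₁ n₂ cr`
by `rfl`) is closed by THIS name: a skeleton composer obtains `KeyedRelWeight cr` as `keyedRelWeight_shape_crGap2₁₃VAx_cutZero ρ ρ′ n₁ n₂` (the `def` is the skeleton's, its body
this Π-type).  No live ∕ off-live split is needed for N20 at the free end. [cite: King1986, (3.10) p.656; Balaban1989LargeFieldII, Thm 1 + (0.1) pp.355–356, (1.80) p.384 (bookkeeping)] -/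
theorem keyedRelWeight_shape_crGap2₁₃VAx_cutZero (ρ ρ' : WidthLetter₁₃CoPHAx 2) (n₁ n₂ : DepthLetter₁₃CoPHAx 2) :
    ∀ (F : T4Family) (θ : Stage13HParams F 2) (hP : θ.Provisos₁₃CoPHAx F 2), (θ.ZhUnity F 2 ∧ θ.SlotsNondegenerate₁₃Ax F 2) → θ.Admissible F 2 →
      ∀ (g₀ : ℕ → ℝ) (os : List (ULoop F)),
        RelWeightBound (crGap2₁₃VAx (fun _ => 0) ρ ρ' n₁ n₂ F θ hP g₀ os).l₀ (crGap2₁₃VAx (fun _ => 0) ρ ρ' n₁ n₂ F θ hP g₀ os).T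
          (crGap2₁₃VAx (fun _ => 0) ρ ρ' n₁ n₂ F θ hP g₀ os).A (crGap2₁₃VAx (fun _ => 0) ρ ρ' n₁ n₂ F θ hP g₀ os).B
          (crGap2₁₃VAx (fun _ => 0) ρ ρ' n₁ n₂ F θ hP g₀ os).Bad (crGap2₁₃VAx (fun _ => 0) ρ ρ' n₁ n₂ F θ hP g₀ os).W :=
  fun _ θ hP _ _ g₀ os => relWeightBound_crGap2₁₃VAtCmap_cutZero (fun F => chiβOfRecord₁₃Ax F 2) 0 ρ ρ' n₁ n₂ θ hP g₀ os

/-- **★ THE `KeyedRelWeight` BODY OF v8 AT THE PER-TUPLE-CUT RE-CENTRED DOUBLY-GAPPED READING FROM A KEYED FAMILY OF WITNESSES AT ITS CARRIERS** (`N = 2`; any cut reading `jc`,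
width letters `ρ ρ′`, depth letters `n₁ n₂`; the weights `W F θ hP g₀ os` may be read per tuple): the socket a PRICED N20 face at a nonzero cut plugs into at the v8 pin.  Both
sides HYPOTHESES at a nonzero cut; NE7b NOT PRINTED for `d = 4`. [cite: Balaban1989LargeFieldII, Thm 1 + (0.1) pp.355–356, (1.79) p.383, (1.80) p.384, (1.89) p.387; King1986, (3.10)–(3.11) p.656 (bookkeeping)] -/
theorem keyedRelWeight_shape_crGap2₁₃VAx_of_witness
    (jc : (F : T4Family) → (θ : Stage13HParams F 2) → θ.Provisos₁₃CoPHAx F 2 → (ℕ → ℝ) → List (ULoop F) → ℕ → ℕ)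
    (ρ ρ' : WidthLetter₁₃CoPHAx 2) (n₁ n₂ : DepthLetter₁₃CoPHAx 2)
    (W : (F : T4Family) → (θ : Stage13HParams F 2) → θ.Provisos₁₃CoPHAx F 2 → (ℕ → ℝ) → List (ULoop F) → ℕ → ℝ)
    (hW : ∀ (F : T4Family) (θ : Stage13HParams F 2) (hP : θ.Provisos₁₃CoPHAx F 2), (θ.ZhUnity F 2 ∧ θ.SlotsNondegenerate₁₃Ax F 2) → θ.Admissible F 2 →
      ∀ (g₀ : ℕ → ℝ) (os : List (ULoop F)),
        RelWeightBound 1 (classSet₁₃Ax θ 0 g₀)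
          (gapWeight2A₁₃Chi θ (chiβOfRecord₁₃Ax F 2 θ.toStage13Params) hP 0 g₀ os (ρ F θ hP g₀ os) (ρ' F θ hP g₀ os) (n₁ F θ hP g₀ os) (n₂ F θ hP g₀ os))
          (gapWeight2B₁₃Chi θ (chiβOfRecord₁₃Ax F 2 θ.toStage13Params) hP 0 g₀ os (ρ F θ hP g₀ os) (ρ' F θ hP g₀ os) (n₁ F θ hP g₀ os) (n₂ F θ hP g₀ os))
          (badClass₁₃Ax θ 0 g₀ (jc F θ hP g₀ os)) (W F θ hP g₀ os)) :
    ∀ (F : T4Family) (θ : Stage13HParams F 2) (hP : θ.Provisos₁₃CoPHAx F 2), (θ.ZhUnity F 2 ∧ θ.SlotsNondegenerate₁₃Ax F 2) → θ.Admissible F 2 →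
      ∀ (g₀ : ℕ → ℝ) (os : List (ULoop F)),
        RelWeightBound (crGap2₁₃VAx (jc F θ hP g₀ os) ρ ρ' n₁ n₂ F θ hP g₀ os).l₀ (crGap2₁₃VAx (jc F θ hP g₀ os) ρ ρ' n₁ n₂ F θ hP g₀ os).T
          (crGap2₁₃VAx (jc F θ hP g₀ os) ρ ρ' n₁ n₂ F θ hP g₀ os).A (crGap2₁₃VAx (jc F θ hP g₀ os) ρ ρ' n₁ n₂ F θ hP g₀ os).B
          (crGap2₁₃VAx (jc F θ hP g₀ os) ρ ρ' n₁ n₂ F θ hP g₀ os).Bad (crGap2₁₃VAx (jc F θ hP g₀ os) ρ ρ' n₁ n₂ F θ hP g₀ os).W :=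
  fun F θ hP hG hθ g₀ os => relWeightBound_crGap2₁₃VAtCmap (fun F => chiβOfRecord₁₃Ax F 2) 0 _ ρ ρ' n₁ n₂ θ hP g₀ os (hW F θ hP hG hθ g₀ os)

/-- **AT THE ZERO CUT THE GOOD CLASS OF THE v8 PIN's READING IS THE WHOLE RE-CENTRED CLASS SET**: the reading's `T K` and `Bad K t` ARE `classSet₁₃Ax θ 0 g₀ K` and
`badClass₁₃Ax θ 0 g₀ (fun _ ↦ 0) K t` (dag-n15-a's dictionary `crGap2₁₃VAtCmap_T ∕ _Bad`, `rfl`), and `classSet₁₃Ax θ 0 g₀ K ∖ badClass₁₃Ax θ 0 g₀ 0 K t = classSet₁₃Ax θ 0 g₀ K` —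
what the `KeyedCoreEdgeHolderD4V` conjunct of the same witness then compares the two runs on: NE7 proper on ALL keyed classes. [cite: King1986, (3.10) p.656 (bookkeeping)] -/
theorem classSet₁₃Ax_sdiff_badClass₁₃Ax_cutZero (θ : Stage13HParams F N) (g₀ : ℕ → ℝ) [DecidableEq ((K : ℕ) × SiteSeqKey F (0 + K))] (K : ℕ) (t : ℝ) :
    classSet₁₃Ax θ 0 g₀ K \ badClass₁₃Ax θ 0 g₀ (fun _ => 0) K t = classSet₁₃Ax θ 0 g₀ K :=
  classSet₁₃Chi_sdiff_badClass₁₃Chi_cutZero θ _ 0 g₀ K t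

end Shape

end Summit.QuantumFields.YangMills.BalabanUVNodes.N20KeyedRelWeightAtGap2ReadingCmap

end
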